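import Summits.QuantumFields.YangMills.Theorems.FlatTubeReductionDecimationContractible
import HarnessLib

/-!
# Route `FlatTubeReduction`, crux `PinnedUnitStepEx` (stmt-QuantumFields-27561), stub `stub_smearVarPosGS1` — D3b/D4c: runs of contractible slices
# under decoding, and translations of coarse link sets

Seat ym-line-fcl-p3 g9 (2026-08-28).  Blueprint D3/D4 continued (the MAX-RUN potential of memo §P4–P5, simplified: per direction, the length of
the longest cyclic window of contractible slices).
* `fine_window_pullback` (M3) — a fine window of length `t+2` in `D ⊆ ℤ/(L'+1)` pulls back, under ANY decoder component `u`, to a coarse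
  window of length `t+1` in `W_u(D) = {a | ι a − u ∈ D}` (whether or not the window passes through the deleted coordinate `1 − u`);
* `isContr_decoded_iff` — for a decoder `(v', R')` of the fine support of `(v, R)` (`fineSupp v' R' = fineSupp v R`), the contractible `j`-slices
  of `R'` are read off the fine contractible set: `IsContr j a R' ↔ IsContr j (ι a − v'_j) F`;
* `hasWindow_decoded_of_fine_window` / `hasWindow_decoded_of_fine_window_avoiding` — hence `R'` has a contractible `j`-window of length `t+1`
  whenever `F` has one of length `t+2`, and of length `t+1` whenever `F` has one of length `t+1` avoiding `1 − v'_j`;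
* `isContr_shift_iff` — contractibility is translation covariant: `IsContr j a (R + w) ↔ IsContr j (a − w_j) R`.
R2b1 RECORD rung; no summit/crux/stub here.
-/

set_option autoImplicit false

namespace Summit.QuantumFields.YangMills.Theorems.FlatTubeReduction.Decimation

open Finset Function
open Literature.MathematicalPhysics.QuantumFieldTheory (Site Edge)
open Summit.QuantumFields.YangMills.Theorems.FemtoCutoffLadder.Thinning

variable {L' : ℕ} [NeZero L']

/-- **(M3) A fine window of length `t+2` pulls back to a coarse window of length `t+1` under every decoder component.** [folklore] -/
theorem fine_window_pullback (u : ZMod (L' + 1)) {D : Finset (ZMod (L' + 1))} {c : ZMod (L' + 1)} {t : ℕ} (ht : t < L')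
    (hD : ∀ i : ℕ, i ≤ t + 1 → c + (i : ZMod (L' + 1)) ∈ D) :
    ∃ a : ZMod L', ∀ i : ℕ, i ≤ t → thinCoord (L' + 1) L' (a + (i : ZMod L')) - u ∈ D := by
  by_cases hc : c = 1 - u
  · -- start one step later: the window `c+1, …, c+t+1` avoids the deleted coordinate `c`
    have hd : ∀ i : ℕ, i ≤ t → (c + 1) + (i : ZMod (L' + 1)) ≠ 1 - u := by
      intro i hi h
      rw [← hc, add_assoc, add_eq_left] at h
      have h1 : ((i + 1 : ℕ) : ZMod (L' + 1)) = 0 := by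
        push_cast
        rcases eq_or_ne ((i : ZMod (L' + 1)) + 1) 0 with h' | h'
        · exact h'
        · exact absurd ((add_comm (1 : ZMod (L' + 1)) i) ▸ h) h'
      rw [ZMod.natCast_eq_zero_iff] at h1
      exact absurd (Nat.le_of_dvd (Nat.succ_pos i) h1) (by omega)
    obtain ⟨a, -, ha⟩ := coarse_window_of_fine_window u hd
    refine ⟨a, fun i hi => ?_⟩
    rw [ha i hi, add_assoc]
    have := hD (i + 1) (by omega)
    rw [Nat.cast_succ, add_comm (i : ZMod (L' + 1)) 1] at this
    exact this
  · have hc1 : c + u ≠ 1 := fun h => hc (by rw [← h, add_sub_cancel_right])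
    obtain ⟨a, ha⟩ := exists_thinCoord_eq hc1
    refine ⟨a, fun i hi => ?_⟩
    by_cases hz : ∃ i₀ : ℕ, i₀ < i ∧ a + (i₀ : ZMod L') = 0
    · obtain ⟨i₀, hi₀, h0⟩ := hz
      rw [thinCoord_add_nat_of_eq_zero a hi₀ (by omega) h0, ha]
      have := hD (i + 1) (by omega)
      rw [Nat.cast_succ] at this
      convert this using 1; ring
    · push Not at hz
      rw [thinCoord_add_nat_of_ne_zero a i (fun i' hi' => hz i' hi'), ha]
      have := hD i (by omega)
      convert this using 1; ring

/-- **Contractible slices of a decoded link set**: if `fineSupp (L'+1) v' R' = F`, then `IsContr j a R' ↔ IsContr j (ι a − v'_j) F`.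
(`isContr_fineSupp_iff` read backwards.) [folklore] -/
theorem isContr_decoded_iff {v' : Site 3 (L' + 1)} {R' : Finset (Edge 3 L')} {F : Finset (Edge 3 (L' + 1))}
    (hF : fineSupp (L' + 1) v' R' = F) (j : Fin 3) (a : ZMod L') :
    IsContr j a R' ↔ IsContr j (thinCoord (L' + 1) L' a - v' j) F := by
  rw [← hF, isContr_fineSupp_iff]

/-- The contractible `j`-slices of a link set, as a `Finset` of fine coordinates (classical). [folklore] -/
theorem mem_contrSlices_iff {M : ℕ} [NeZero M] {j : Fin 3} {R : Finset (Edge 3 M)} {c : ZMod M} :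
    c ∈ contrSlices j R ↔ IsContr j c R := by
  classical
  unfold contrSlices
  simp only [Finset.mem_filter, Finset.mem_univ, true_and]

/-- **A decoded link set inherits long windows**: if `fineSupp (L'+1) v' R' = F` and `F` has a window `c, …, c+t+1` of contractible `j`-slices
(`t < L'`), then `R'` has a window of `t+1` consecutive contractible `j`-slices. [folklore] -/
theorem hasWindow_decoded_of_fine_window {v' : Site 3 (L' + 1)} {R' : Finset (Edge 3 L')} {F : Finset (Edge 3 (L' + 1))}
    (hF : fineSupp (L' + 1) v' R' = F) (j : Fin 3) {c : ZMod (L' + 1)} {t : ℕ} (ht : t < L')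
    (hwin : ∀ i : ℕ, i ≤ t + 1 → IsContr j (c + (i : ZMod (L' + 1))) F) :
    ∃ a : ZMod L', ∀ i : ℕ, i ≤ t → IsContr j (a + (i : ZMod L')) R' := by
  classical
  obtain ⟨a, ha⟩ := fine_window_pullback (v' j) (D := contrSlices j F) ht (fun i hi => mem_contrSlices_iff.2 (hwin i hi))
  exact ⟨a, fun i hi => (isContr_decoded_iff hF j _).2 (mem_contrSlices_iff.1 (ha i hi))⟩

/-- **… and windows avoiding its deleted slice**: if `F` has a window `c, …, c+t` of contractible `j`-slices none of which is `1 − v'_j`, then `R'`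
has a window of `t+1` consecutive contractible `j`-slices. [folklore] -/
theorem hasWindow_decoded_of_fine_window_avoiding {v' : Site 3 (L' + 1)} {R' : Finset (Edge 3 L')} {F : Finset (Edge 3 (L' + 1))}
    (hF : fineSupp (L' + 1) v' R' = F) (j : Fin 3) {c : ZMod (L' + 1)} {t : ℕ}
    (hwin : ∀ i : ℕ, i ≤ t → IsContr j (c + (i : ZMod (L' + 1))) F) (havoid : ∀ i : ℕ, i ≤ t → c + (i : ZMod (L' + 1)) ≠ 1 - v' j) :
    ∃ a : ZMod L', ∀ i : ℕ, i ≤ t → IsContr j (a + (i : ZMod L')) R' := by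
  obtain ⟨a, -, ha⟩ := coarse_window_of_fine_window (v' j) havoid
  exact ⟨a, fun i hi => (isContr_decoded_iff hF j _).2 (by rw [ha i hi]; exact hwin i hi)⟩

/-! ## Translations of coarse link sets -/

/-- **Contractibility is translation covariant**: for the translated link set `R + w := {(x + w, i) : (x, i) ∈ R}`,
`IsContr j a (R + w) ↔ IsContr j (a − w_j) R`. [folklore] -/
theorem isContr_shift_iff {M : ℕ} (j : Fin 3) (a : ZMod M) (w : Site 3 M) (R : Finset (Edge 3 M)) :
    IsContr j a (R.image fun e => (e.1 + w, e.2)) ↔ IsContr j (a - w j) R := by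
  have hmem : ∀ (y : Site 3 M) (i : Fin 3), (y, i) ∈ R.image (fun e => (e.1 + w, e.2)) ↔ (y - w, i) ∈ R := by
    intro y i
    simp only [Finset.mem_image, Prod.mk.injEq, Prod.exists]
    constructor
    · rintro ⟨x, i', h, hx, rfl⟩
      rw [← hx, add_sub_cancel_right]; exact h
    · intro h
      exact ⟨y - w, i, h, sub_add_cancel y w, rfl⟩
  constructor
  · rintro ⟨hi, hii⟩
    refine ⟨fun e he hej => ?_, fun y hy => ?_⟩
    · have := hi (e.1 + w, e.2) ((hmem _ _).2 (by simpa using he)) (by simp [Pi.add_apply, hej])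
      exact this
    · have h := hii (y + w) (by simp [Pi.add_apply, hy])
      rw [hmem, hmem, add_sub_right_comm, add_sub_cancel_right, add_sub_cancel_right] at h
      exact h
  · rintro ⟨hi, hii⟩
    refine ⟨fun e he hej => ?_, fun y hy => ?_⟩
    · have h := (hmem e.1 e.2).1 (by simpa using he)
      exact hi (e.1 - w, e.2) h (by simp [hej])
    · have h := hii (y - w) (by simp [Pi.sub_apply, hy])
      rw [hmem, hmem, sub_right_comm]
      exact h

end Summit.QuantumFields.YangMills.Theorems.FlatTubeReduction.Decimation
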